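import Literature.Barriers.RiemannHypothesis.MollifierLimitationsProofs
import Mathlib.MeasureTheory.Function.Floor
import Literature.NumberTheory.LFunctions.ZetaRealAxis
import Literature.NumberTheory.LFunctions.NymanBeurlingDirichlet
import HarnessLib

/-!
# Bettin–Gonek 2017, Theorem 1: reduction to the key lower bound of §2, and assembly of the barrier

Sibling of `Literature/Barriers/RiemannHypothesis/MollifierLimitations.lean` (the barrier
`MollifierLimitations := Radziwill2012_thm1 ∧ BettinGonek2017_thm1`) and of
`MollifierLimitationsProofs.lean` (Radziwiłł's half: `Radziwill2012_thm1_of_inputs`). This file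
treats the Bettin–Gonek half. S. Bettin, S. M. Gonek, *The θ = ∞ conjecture implies the Riemann
hypothesis*, Mathematika 63 (2017) 29–33 = arXiv:1604.02740, Theorem 1: if for every `ε > 0`,
`I_N(0,T) ≪_ε T^{1+ε}` for `2 ≤ N ≤ T^θ`, then `ζ(s) ≠ 0` for `Re s > 1/2 + 1/(2θ)`.

The printed proof (§2, p. 4) has an analytic heart and a short endgame:

* (heart) for a zero `ρ₀ = β₀ + iγ₀` of `ζ` with `β₀ ≥ 1/2`, a Mellin-transform/contour-shift
  argument gives, after Cauchy–Schwarz, the pointwise bound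
  `x^{2β₀}/(1+|t|)⁴ + 1/x ≪ ∫_1^x |M_y(½+it)|² log² y dy` (`x ≥ 2`, all real `t`), where
  `M_y(s) log y = ∑_{n ≤ y} μ(n) n^{-s} log(y/n)` extends the Levinson–Conrey mollifier to real
  lengths `y`. This is vendored here as the named fact `BettinGonek2017_lowerBound` (to be
  discharged separately; the inputs it needs — `(s−1)ζ(s)` entire, the Euler–Maclaurin growth
  bound `Literature.NumberTheory.LFunctions.norm_riemannZeta_le_of_neg_one_le_re`, line shifting
  `Literature.NumberTheory.LFunctions.MertensBoundRH.integral_vertical_eq_of_tendsto` and the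
  two-pole bookkeeping `Literature.Analysis.Complex.VLI.integral_inv_sub_inv` — are all in the
  tree);
* (endgame, PROVED here as `BettinGonek2017_thm1_of_lowerBound`) "Multiplying both sides by
  `|ζ(½+it)|²` and integrating […] taking `T₁ = 0`, `T₂ = T`, and `x = T^θ`, we obtain
  `T^{2β₀θ} ≪_ε T^{1+ε+θ}`. Letting `T → ∞` […] we obtain `β₀ ≤ ½ + 1/(2θ)`."

## The endgame as formalised (design notes)

* The vendored hypothesis of `BettinGonek2017_thm1` is the printed one, over *integer* lengths
  `2 ≤ N ≤ T^θ`, while the heart integrates over *real* lengths `y ∈ [1, x]`. The bridge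
  (`norm_levinsonMollifierLog_le_max`): on `[N, N+1]` the map `y ↦ M_y(s) log y` is affine in
  `log y`, and letting `y ↑ N+1` adds the term `n = N+1` with weight `log((N+1)/(N+1)) = 0`, so
  `|M_y log y| ≤ max(|M_N log N|, |M_{N+1} log(N+1)|)` and
  `∫_1^x |M_y log y|² dy ≤ ∑_{N ≤ x} (|M_N log N|² + |M_{N+1} log(N+1)|²)`
  (`integral_norm_sq_levinsonMollifierLog_le`); lengths up to `⌊x⌋ + 1 ≤ 2T^θ = (2^{1/θ}T)^θ`
  are covered by the hypothesis at `2^{1/θ} T`, using that `I_N(0, ·)` is monotone.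
* Only the first term `x^{2β₀}/(1+|t|)⁴` of the lower bound is used, and the `t`-integration is
  over `[0, 1]` (where `I_N(0,1) ≤ I_N(0,T)`): this needs only `∫_0^1 |ζ(½+it)|² dt > 0`
  (`integral_norm_sq_riemannZeta_pos`, from `ζ(½) ≠ 0`, `ZetaRealAxis.lean`, and the continuity
  of `t ↦ ζ(½+it)`, `NymanBeurlingDirichlet.lean`) instead of the printed
  `∫_{T₁}^{T₂} |ζ(½+it)|² dt ≫ T₂ log(T₂ + 2)`, which the printed argument for Theorem 1 does not
  actually require.
* With `2β₀θ = θ + 1 + 4η`, `ε = η` and `log(2T^θ) ≤ (1+θ) T^η/η` the printed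
  "`T^{2β₀θ} ≪ T^{1+ε+θ}`, let `T → ∞`" becomes `T^η ≤ const`, contradicting `T^η → ∞`.
* `MollifierLimitations_of` assembles the barrier from its four printed leaves
  (`Radziwill2012_propA`, `Radziwill2012_lemma5`, `Radziwill2012_propB`,
  `BettinGonek2017_lowerBound`).

## References

* [BettinGonek2017] S. Bettin, S. M. Gonek, *The θ = ∞ conjecture implies the Riemann
  hypothesis*, Mathematika 63 (2017), no. 1, 29–33; arXiv:1604.02740: Thm. 1 (p. 3), §2 (p. 4:
  the definition of `M_x(s) log x`, the display after "It follows from the Cauchy–Schwarz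
  inequality", and the closing paragraph).
* [Radziwill2012] M. Radziwiłł, *Limitations to mollifying ζ(s)*, arXiv:1207.6583, §4.
-/

noncomputable section

open Complex MeasureTheory Real
open scoped ArithmeticFunction.Moebius

namespace Literature.Barriers.RiemannHypothesis

/-- Bettin–Gonek's extension of the Levinson–Conrey mollifier to a real length `x > 0`, multiplied
through by `log x`: `M_x(s) log x = ∑_{n ≤ x} μ(n) n^{-s} log(x/n)` (Bettin–Gonek 2017, §2, first
display); the sum is empty for `x < 1` and vanishes at `x = 1` (their convention `M_1 := 0`).
[cite: BettinGonek2017, §2] -/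
def levinsonMollifierLog (x : ℝ) (s : ℂ) : ℂ :=
  ∑ n ∈ Finset.Icc 1 ⌊x⌋₊, ((μ n : ℤ) : ℂ) * (n : ℂ) ^ (-s) * ((Real.log (x / n) : ℝ) : ℂ)

/-- `M_x log x = 0` for `x < 1` (empty sum). [cite: BettinGonek2017, §2] -/
theorem levinsonMollifierLog_of_lt_one {x : ℝ} (hx : x < 1) (s : ℂ) :
    levinsonMollifierLog x s = 0 := by
  unfold levinsonMollifierLog
  rw [Nat.floor_eq_zero.mpr (by simpa using hx)]
  · simp

/-- At a natural number `N`, `M_N log N` is the mollifier `levinsonMollifier N` of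
`MollifierLimitations.lean` times `log N` (both sides vanish for `N ≤ 1`).
[cite: BettinGonek2017, §2] -/
theorem levinsonMollifierLog_natCast (N : ℕ) (s : ℂ) :
    levinsonMollifierLog N s = levinsonMollifier N s * Real.log N := by
  unfold levinsonMollifierLog levinsonMollifier
  rw [Nat.floor_natCast, Finset.sum_mul]
  refine Finset.sum_congr rfl fun n hn ↦ ?_
  have hn1 : 1 ≤ n := (Finset.mem_Icc.1 hn).1
  have hnN : n ≤ N := (Finset.mem_Icc.1 hn).2
  have hn0 : (0 : ℝ) < n := by exact_mod_cast hn1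
  have hN0 : (0 : ℝ) < N := by exact_mod_cast (le_trans hn1 hnN)
  rw [Real.log_div hN0.ne' hn0.ne']
  rcases eq_or_ne N 1 with h1 | h1
  · subst h1
    have : n = 1 := le_antisymm hnN hn1
    subst this
    simp
  · have hlogN : Real.log N ≠ 0 := by
      apply Real.log_ne_zero_of_pos_of_ne_one hN0
      exact_mod_cast h1
    have hlogN' : ((Real.log N : ℝ) : ℂ) ≠ 0 := Complex.ofReal_ne_zero.mpr hlogN
    simp only [Complex.ofReal_sub, Complex.ofReal_div, Complex.ofReal_one]
    field_simp

/-- The affine form in `log y`: `M_y(s) log y = log y · ∑_{n ≤ y} μ(n) n^{-s} − ∑_{n ≤ y} μ(n) n^{-s} log n`.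
[cite: BettinGonek2017, §2] -/
theorem levinsonMollifierLog_eq_log_mul_sub (y : ℝ) (s : ℂ) :
    levinsonMollifierLog y s =
      (Real.log y : ℂ) * (∑ n ∈ Finset.Icc 1 ⌊y⌋₊, ((μ n : ℤ) : ℂ) * (n : ℂ) ^ (-s)) -
        ∑ n ∈ Finset.Icc 1 ⌊y⌋₊, ((μ n : ℤ) : ℂ) * (n : ℂ) ^ (-s) * (Real.log n : ℂ) := by
  unfold levinsonMollifierLog
  rw [Finset.mul_sum, ← Finset.sum_sub_distrib]
  refine Finset.sum_congr rfl fun n hn ↦ ?_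
  have hn1 : 1 ≤ n := (Finset.mem_Icc.1 hn).1
  have hny : n ≤ ⌊y⌋₊ := (Finset.mem_Icc.1 hn).2
  have hn0 : (0 : ℝ) < n := by exact_mod_cast hn1
  have hy0 : 0 < y := by
    by_contra h
    rw [Nat.floor_of_nonpos (not_lt.1 h)] at hny
    omega
  rw [Real.log_div hy0.ne' hn0.ne', Complex.ofReal_sub]
  ring

/-- `y ↦ ∑_{n ≤ y} c(n)` is measurable (a step function). [folklore] -/
theorem measurable_sum_Icc_floor (c : ℕ → ℂ) :
    Measurable fun y : ℝ ↦ ∑ n ∈ Finset.Icc 1 ⌊y⌋₊, c n :=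
  (measurable_from_nat (f := fun k : ℕ ↦ ∑ n ∈ Finset.Icc 1 k, c n)).comp Nat.measurable_floor

/-- `y ↦ M_y(s) log y` is measurable. [cite: BettinGonek2017, §2] -/
theorem measurable_levinsonMollifierLog (s : ℂ) :
    Measurable fun y : ℝ ↦ levinsonMollifierLog y s := by
  have h : (fun y : ℝ ↦ levinsonMollifierLog y s) = fun y : ℝ ↦
      (Real.log y : ℂ) * (∑ n ∈ Finset.Icc 1 ⌊y⌋₊, ((μ n : ℤ) : ℂ) * (n : ℂ) ^ (-s)) -
        ∑ n ∈ Finset.Icc 1 ⌊y⌋₊, ((μ n : ℤ) : ℂ) * (n : ℂ) ^ (-s) * (Real.log n : ℂ) := by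
    funext y; exact levinsonMollifierLog_eq_log_mul_sub y s
  rw [h]
  exact ((Complex.measurable_ofReal.comp Real.measurable_log).mul (measurable_sum_Icc_floor _)).sub
    (measurable_sum_Icc_floor _)

/-- `s ↦ M_y(s) log y` is continuous. [cite: BettinGonek2017, §2] -/
theorem continuous_levinsonMollifierLog (y : ℝ) :
    Continuous fun s : ℂ ↦ levinsonMollifierLog y s := by
  unfold levinsonMollifierLog
  refine continuous_finsetSum _ fun n hn ↦ ?_
  have hn1 : 1 ≤ n := (Finset.mem_Icc.1 hn).1
  have hn0 : (n : ℂ) ≠ 0 := by exact_mod_cast (show n ≠ 0 by omega)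
  exact (continuous_const.mul (continuous_const.cpow continuous_neg fun _ ↦
    Or.inl (by exact_mod_cast Nat.pos_of_ne_zero (show n ≠ 0 by omega)))).mul continuous_const

/-- Termwise bound: `‖μ(n) n^{-s} log(y/n)‖ ≤ log y` for `1 ≤ n ≤ y` and `Re s ≥ 0`. [folklore] -/
theorem norm_levinsonMollifierLog_term_le {y : ℝ} {s : ℂ} (hs : 0 ≤ s.re) {n : ℕ} (hn : n ∈ Finset.Icc 1 ⌊y⌋₊) :
    ‖((μ n : ℤ) : ℂ) * (n : ℂ) ^ (-s) * ((Real.log (y / n) : ℝ) : ℂ)‖ ≤ Real.log y := by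
  have hn1 : 1 ≤ n := (Finset.mem_Icc.1 hn).1
  have hny : n ≤ ⌊y⌋₊ := (Finset.mem_Icc.1 hn).2
  have hn0 : (0 : ℝ) < n := by exact_mod_cast hn1
  have hy1 : (n : ℝ) ≤ y := by
    have hy : 0 ≤ y := by
      by_contra h
      rw [Nat.floor_of_nonpos (not_le.1 h).le] at hny; omega
    exact le_trans (by exact_mod_cast hny) (Nat.floor_le hy)
  have hy0 : 0 < y := lt_of_lt_of_le hn0 hy1
  rw [norm_mul, norm_mul, Complex.norm_intCast, Complex.norm_natCast_cpow_of_pos (by omega),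
    Complex.norm_real, Real.norm_eq_abs]
  have h1 : |(μ n : ℝ)| ≤ 1 := by exact_mod_cast ArithmeticFunction.abs_moebius_le_one
  have h2 : (n : ℝ) ^ (-s).re ≤ 1 := by
    rw [Complex.neg_re]
    exact Real.rpow_le_one_of_one_le_of_nonpos (by exact_mod_cast hn1) (by linarith)
  have h3 : |Real.log (y / n)| ≤ Real.log y := by
    rw [abs_of_nonneg (Real.log_nonneg ((one_le_div hn0).2 hy1)), Real.log_div hy0.ne' hn0.ne']
    linarith [Real.log_nonneg (show (1 : ℝ) ≤ n by exact_mod_cast hn1)]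
  calc |(μ n : ℝ)| * (n : ℝ) ^ (-s).re * |Real.log (y / n)|
      ≤ 1 * 1 * Real.log y := by
        gcongr
    _ = Real.log y := by ring

/-- `‖M_y(s) log y‖ ≤ ⌊y⌋ log y` for `Re s ≥ 0`. [cite: BettinGonek2017, §2] -/
theorem norm_levinsonMollifierLog_le {s : ℂ} (hs : 0 ≤ s.re) (y : ℝ) :
    ‖levinsonMollifierLog y s‖ ≤ ⌊y⌋₊ * Real.log y := by
  unfold levinsonMollifierLog
  refine (norm_sum_le _ _).trans ?_
  calc ∑ n ∈ Finset.Icc 1 ⌊y⌋₊, ‖((μ n : ℤ) : ℂ) * (n : ℂ) ^ (-s) * ((Real.log (y / n) : ℝ) : ℂ)‖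
      ≤ ∑ n ∈ Finset.Icc 1 ⌊y⌋₊, Real.log y := Finset.sum_le_sum fun n hn ↦ norm_levinsonMollifierLog_term_le hs hn
    _ = ⌊y⌋₊ * Real.log y := by simp

/-- Convexity of the norm along an affine path: for `a ≤ λ ≤ b`,
`‖λA − B‖ ≤ max ‖aA − B‖ ‖bA − B‖`. [folklore] -/
theorem norm_affine_le_max (A B : ℂ) {a b lam : ℝ} (ha : a ≤ lam) (hb : lam ≤ b) :
    ‖(lam : ℂ) * A - B‖ ≤ max ‖(a : ℂ) * A - B‖ ‖(b : ℂ) * A - B‖ := by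
  rcases eq_or_lt_of_le (le_trans ha hb) with hab | hab
  · have : lam = a := le_antisymm (hab ▸ hb) ha
    subst this
    exact le_max_left _ _
  · set θ : ℝ := (lam - a) / (b - a) with hθ
    have hba : 0 < b - a := by linarith
    have hθ0 : 0 ≤ θ := div_nonneg (by linarith) hba.le
    have hθ1 : θ ≤ 1 := (div_le_one hba).2 (by linarith)
    have hlam : lam = (1 - θ) * a + θ * b := by
      rw [hθ]; field_simp; ring
    have hdecomp : (lam : ℂ) * A - B =
        ((1 - θ : ℝ) : ℂ) * ((a : ℂ) * A - B) + ((θ : ℝ) : ℂ) * ((b : ℂ) * A - B) := by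
      rw [hlam]; push_cast; ring
    rw [hdecomp]
    calc ‖((1 - θ : ℝ) : ℂ) * ((a : ℂ) * A - B) + ((θ : ℝ) : ℂ) * ((b : ℂ) * A - B)‖
        ≤ ‖((1 - θ : ℝ) : ℂ) * ((a : ℂ) * A - B)‖ + ‖((θ : ℝ) : ℂ) * ((b : ℂ) * A - B)‖ :=
          norm_add_le _ _
      _ = (1 - θ) * ‖(a : ℂ) * A - B‖ + θ * ‖(b : ℂ) * A - B‖ := by
          rw [norm_mul, norm_mul, Complex.norm_real, Complex.norm_real, Real.norm_eq_abs,
            Real.norm_eq_abs, abs_of_nonneg (by linarith), abs_of_nonneg hθ0]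
      _ ≤ (1 - θ) * max ‖(a : ℂ) * A - B‖ ‖(b : ℂ) * A - B‖ +
            θ * max ‖(a : ℂ) * A - B‖ ‖(b : ℂ) * A - B‖ := by
          gcongr
          · exact le_max_left _ _
          · exact le_max_right _ _
      _ = max ‖(a : ℂ) * A - B‖ ‖(b : ℂ) * A - B‖ := by ring

/-- **The bridge between real and integer lengths.** On `[N, N+1]` the function `y ↦ M_y(s) log y`
is affine in `log y` and continuous at `N + 1` (the new term `n = N + 1` enters with weight
`log((N+1)/(N+1)) = 0`), so `‖M_y(s) log y‖ ≤ max(‖M_N log N‖, ‖M_{N+1} log(N+1)‖)`, `N = ⌊y⌋ ≥ 1`.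
[cite: BettinGonek2017, §2] -/
theorem norm_levinsonMollifierLog_le_max {y : ℝ} (hy : 1 ≤ y) (s : ℂ) :
    ‖levinsonMollifierLog y s‖ ≤
      max ‖levinsonMollifierLog (⌊y⌋₊ : ℕ) s‖ ‖levinsonMollifierLog ((⌊y⌋₊ + 1 : ℕ) : ℝ) s‖ := by
  set N := ⌊y⌋₊ with hN
  have hN1 : 1 ≤ N := Nat.le_floor (by simpa using hy)
  have hy0 : 0 < y := by linarith
  have hNy : (N : ℝ) ≤ y := Nat.floor_le hy0.le
  have hyN : y < N + 1 := Nat.lt_floor_add_one y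
  set A : ℂ := ∑ n ∈ Finset.Icc 1 N, ((μ n : ℤ) : ℂ) * (n : ℂ) ^ (-s) with hA
  set B : ℂ := ∑ n ∈ Finset.Icc 1 N, ((μ n : ℤ) : ℂ) * (n : ℂ) ^ (-s) * (Real.log n : ℂ) with hB
  have h1 : levinsonMollifierLog y s = (Real.log y : ℂ) * A - B :=
    levinsonMollifierLog_eq_log_mul_sub y s
  have h2 : levinsonMollifierLog (N : ℝ) s = (Real.log N : ℂ) * A - B := by
    rw [levinsonMollifierLog_eq_log_mul_sub, Nat.floor_natCast]
  have h3 : levinsonMollifierLog ((N + 1 : ℕ) : ℝ) s = (Real.log ((N + 1 : ℕ) : ℝ) : ℂ) * A - B := by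
    rw [levinsonMollifierLog_eq_log_mul_sub, Nat.floor_natCast, Finset.sum_Icc_succ_top (by omega),
      Finset.sum_Icc_succ_top (by omega), ← hA, ← hB]
    push_cast
    ring
  rw [h1, h2, h3]
  refine norm_affine_le_max A B (Real.log_le_log (by exact_mod_cast hN1) hNy) ?_
  exact Real.log_le_log hy0 (by exact_mod_cast hyN.le)

/-- Squared form of the bridge: `‖M_y log y‖² ≤ ‖M_N log N‖² + ‖M_{N+1} log(N+1)‖²`, `N = ⌊y⌋`,
`y ≥ 1`. [cite: BettinGonek2017, §2] -/
theorem norm_sq_levinsonMollifierLog_le {y : ℝ} (hy : 1 ≤ y) (s : ℂ) :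
    ‖levinsonMollifierLog y s‖ ^ 2 ≤
      ‖levinsonMollifierLog (⌊y⌋₊ : ℕ) s‖ ^ 2 +
        ‖levinsonMollifierLog ((⌊y⌋₊ + 1 : ℕ) : ℝ) s‖ ^ 2 := by
  have h := norm_levinsonMollifierLog_le_max hy s
  have h0 := norm_nonneg (levinsonMollifierLog y s)
  rcases le_max_iff.1 h with h' | h'
  · nlinarith [norm_nonneg (levinsonMollifierLog ((⌊y⌋₊ + 1 : ℕ) : ℝ) s)]
  · nlinarith [norm_nonneg (levinsonMollifierLog (⌊y⌋₊ : ℕ) s)]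

/-- Crude size bound: `‖M_y(s) log y‖ ≤ y²` for `Re s ≥ 0` (all real `y`). [cite: BettinGonek2017, §2] -/
theorem norm_levinsonMollifierLog_le_sq {s : ℂ} (hs : 0 ≤ s.re) (y : ℝ) :
    ‖levinsonMollifierLog y s‖ ≤ y ^ 2 := by
  rcases lt_or_ge y 1 with hy | hy
  · rw [levinsonMollifierLog_of_lt_one hy]; simp only [norm_zero]; positivity
  · have hy0 : 0 < y := by linarith
    calc ‖levinsonMollifierLog y s‖ ≤ ⌊y⌋₊ * Real.log y := norm_levinsonMollifierLog_le hs y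
      _ ≤ y * y := by
          gcongr
          · exact Real.log_nonneg hy
          · exact Nat.floor_le hy0.le
          · exact (Real.log_le_sub_one_of_pos hy0).trans (by linarith)
      _ = y ^ 2 := by ring

/-- `y ↦ ‖M_y(s) log y‖²` is interval integrable (bounded and measurable), `Re s ≥ 0`.
[cite: BettinGonek2017, §2] -/
theorem intervalIntegrable_norm_sq_levinsonMollifierLog {s : ℂ} (hs : 0 ≤ s.re) (a b : ℝ) :
    IntervalIntegrable (fun y : ℝ ↦ ‖levinsonMollifierLog y s‖ ^ 2) volume a b := by
  rw [intervalIntegrable_iff]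
  refine Measure.integrableOn_of_bounded (M := (max |a| |b|) ^ 4) measure_Ioc_lt_top.ne
    ((measurable_levinsonMollifierLog s).norm.pow_const 2).aestronglyMeasurable ?_
  refine (ae_restrict_iff' measurableSet_uIoc).2 (Filter.Eventually.of_forall fun y hy ↦ ?_)
  have hyM : |y| ≤ max |a| |b| := by
    rcases Set.mem_uIoc.1 hy with ⟨h1, h2⟩ | ⟨h1, h2⟩
    · exact abs_le_max_abs_abs h1.le h2
    · rw [max_comm]; exact abs_le_max_abs_abs h1.le h2
  rw [Real.norm_eq_abs, abs_of_nonneg (by positivity)]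
  calc ‖levinsonMollifierLog y s‖ ^ 2 ≤ (y ^ 2) ^ 2 := by
        gcongr; exact norm_levinsonMollifierLog_le_sq hs y
    _ = |y| ^ 4 := by rw [← sq_abs y]; ring
    _ ≤ (max |a| |b|) ^ 4 := by gcongr

/-- **Integrated bridge.** For `x ≥ 1` and `Re s ≥ 0`,
`∫_1^x ‖M_y(s) log y‖² dy ≤ ∑_{N ≤ x} (‖M_N log N‖² + ‖M_{N+1} log(N+1)‖²)` (evaluated at `s`).
[cite: BettinGonek2017, §2] -/
theorem integral_norm_sq_levinsonMollifierLog_le {x : ℝ} (hx : 1 ≤ x) {s : ℂ} (hs : 0 ≤ s.re) :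
    ∫ y in (1 : ℝ)..x, ‖levinsonMollifierLog y s‖ ^ 2 ≤
      ∑ N ∈ Finset.Icc 1 ⌊x⌋₊, (‖levinsonMollifierLog (N : ℝ) s‖ ^ 2 +
        ‖levinsonMollifierLog ((N + 1 : ℕ) : ℝ) s‖ ^ 2) := by
  set K := ⌊x⌋₊ with hK
  set f : ℝ → ℝ := fun y ↦ ‖levinsonMollifierLog y s‖ ^ 2 with hf
  set g : ℕ → ℝ := fun N ↦ ‖levinsonMollifierLog (N : ℝ) s‖ ^ 2 +
    ‖levinsonMollifierLog ((N + 1 : ℕ) : ℝ) s‖ ^ 2 with hg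
  have hK1 : 1 ≤ K := Nat.le_floor (by simpa using hx)
  have hxK : x ≤ (K : ℝ) + 1 := (Nat.lt_floor_add_one x).le
  -- enlarge the interval
  have h1 : ∫ y in (1 : ℝ)..x, f y ≤ ∫ y in (1 : ℝ)..((K : ℝ) + 1), f y :=
    intervalIntegral.integral_mono_interval le_rfl hx hxK
      (Filter.Eventually.of_forall fun y ↦ by positivity)
      (intervalIntegrable_norm_sq_levinsonMollifierLog hs _ _)
  -- split at the integers
  have h2 : ∑ k ∈ Finset.range K, ∫ y in ((k : ℝ) + 1)..((((k + 1 : ℕ)) : ℝ) + 1), f y =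
      ∫ y in (((0 : ℕ) : ℝ) + 1)..((K : ℝ) + 1), f y :=
    intervalIntegral.sum_integral_adjacent_intervals (a := fun k : ℕ ↦ (k : ℝ) + 1)
      fun k _ ↦ intervalIntegrable_norm_sq_levinsonMollifierLog hs _ _
  simp only [Nat.cast_zero, zero_add] at h2
  -- each piece
  have h3 : ∀ k ∈ Finset.range K,
      ∫ y in ((k : ℝ) + 1)..(((k + 1 : ℕ) : ℝ) + 1), f y ≤ g (k + 1) := by
    intro k _
    have hle : ∀ y ∈ Set.uIoc ((k : ℝ) + 1) (((k + 1 : ℕ) : ℝ) + 1), ‖f y‖ ≤ g (k + 1) := by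
      intro y hy
      rw [Set.uIoc_of_le (by push_cast; linarith)] at hy
      obtain ⟨hy1, hy2⟩ := hy
      rw [hf, Real.norm_eq_abs, abs_of_nonneg (by positivity), hg]
      rcases eq_or_lt_of_le hy2 with heq | hlt
      · rw [heq]
        have : ((k + 1 : ℕ) : ℝ) + 1 = ((k + 1 + 1 : ℕ) : ℝ) := by push_cast; ring
        rw [this]
        linarith [sq_nonneg ‖levinsonMollifierLog ((k + 1 : ℕ) : ℝ) s‖]
      · have hfl : ⌊y⌋₊ = k + 1 := by
          rw [Nat.floor_eq_iff (by linarith)]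
          exact ⟨by push_cast; linarith, by exact_mod_cast hlt⟩
        have := norm_sq_levinsonMollifierLog_le (y := y) (by linarith) s
        rw [hfl] at this
        exact this
    have := intervalIntegral.norm_integral_le_of_norm_le_const hle
    have habs : |(((k + 1 : ℕ) : ℝ) + 1) - ((k : ℝ) + 1)| = 1 := by push_cast; ring_nf; simp
    rw [habs, mul_one, Real.norm_eq_abs] at this
    exact (le_abs_self _).trans this
  -- reindex the sum
  have h4 : ∑ k ∈ Finset.range K, g (k + 1) = ∑ N ∈ Finset.Icc 1 K, g N := by
    rw [← Finset.Ico_add_one_right_eq_Icc, Finset.sum_Ico_eq_sum_range]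
    refine Finset.sum_congr (by simp) fun k _ ↦ by rw [add_comm]
  calc ∫ y in (1 : ℝ)..x, f y ≤ ∫ y in (1 : ℝ)..((K : ℝ) + 1), f y := h1
    _ = ∑ k ∈ Finset.range K, ∫ y in ((k : ℝ) + 1)..(((k + 1 : ℕ) : ℝ) + 1), f y := h2.symm
    _ ≤ ∑ k ∈ Finset.range K, g (k + 1) := Finset.sum_le_sum h3
    _ = ∑ N ∈ Finset.Icc 1 K, g N := h4

/-- `∫_0^1 |ζ(½ + it)|² dt > 0` (continuity and `ζ(½) ≠ 0`). [folklore] -/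
theorem integral_norm_sq_riemannZeta_pos :
    0 < ∫ t in (0 : ℝ)..1, ‖riemannZeta (1 / 2 + t * I)‖ ^ 2 := by
  have hcont : Continuous fun t : ℝ ↦ ‖riemannZeta (1 / 2 + t * I)‖ ^ 2 :=
    (Literature.NumberTheory.LFunctions.continuous_riemannZeta_line.norm).pow 2
  have h0 : (0 : ℝ) < ‖riemannZeta (1 / 2 + (0 : ℝ) * I)‖ ^ 2 := by
    have h12 : (1 / 2 : ℂ) + (0 : ℝ) * I = ((1 / 2 : ℝ) : ℂ) := by push_cast; ring
    rw [h12]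
    have := Literature.NumberTheory.LFunctions.riemannZeta_ofReal_ne_zero_of_nonneg_of_lt_one
      (σ := 1 / 2) (by norm_num) (by norm_num)
    positivity
  have h := intervalIntegral.integral_lt_integral_of_continuousOn_of_le_of_exists_lt zero_lt_one
    continuousOn_const hcont.continuousOn (fun t _ ↦ by positivity) ⟨0, by simp, h0⟩
  simpa using h

/-- `t ↦ M_N(½ + it)` (the mollifier of `MollifierLimitations.lean`) is continuous. [folklore] -/
theorem continuous_levinsonMollifier_criticalLine (N : ℕ) :
    Continuous fun t : ℝ ↦ levinsonMollifier N (1 / 2 + t * I) := by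
  have h : Continuous fun s : ℂ ↦ levinsonMollifier N s := by
    unfold levinsonMollifier
    refine continuous_finsetSum _ fun n hn ↦ ?_
    have hn1 : 1 ≤ n := (Finset.mem_Icc.1 hn).1
    exact continuous_const.mul (continuous_const.cpow continuous_neg fun _ ↦
      Or.inl (by exact_mod_cast Nat.pos_of_ne_zero (show n ≠ 0 by omega)))
  exact h.comp (by fun_prop)

/-- On the critical line, `∫_{T₁}^{T₂} ‖M_N log N‖² |ζ|² dt = log² N · I_N(T₁, T₂)`.
[cite: BettinGonek2017, §2] -/
theorem integral_norm_sq_levinsonMollifierLog_natCast (N : ℕ) (T₁ T₂ : ℝ) :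
    ∫ t in T₁..T₂, ‖levinsonMollifierLog (N : ℝ) (1 / 2 + t * I)‖ ^ 2 *
        ‖riemannZeta (1 / 2 + t * I)‖ ^ 2 =
      Real.log N ^ 2 * mollifiedSecondMoment N T₁ T₂ := by
  unfold mollifiedSecondMoment
  rw [← intervalIntegral.integral_const_mul]
  refine intervalIntegral.integral_congr fun t _ ↦ ?_
  simp only [levinsonMollifierLog_natCast, norm_mul, Complex.norm_real, Real.norm_eq_abs]
  rw [mul_pow, sq_abs]; ring

/-- `I_N(0, ·)` is monotone (the integrand is non-negative). [cite: BettinGonek2017, §1] -/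
theorem mollifiedSecondMoment_mono (N : ℕ) {T T' : ℝ} (hT : 0 ≤ T) (hTT' : T ≤ T') :
    mollifiedSecondMoment N 0 T ≤ mollifiedSecondMoment N 0 T' := by
  unfold mollifiedSecondMoment
  refine intervalIntegral.integral_mono_interval le_rfl hT hTT'
    (Filter.Eventually.of_forall fun t ↦ by positivity) ?_
  exact ((((continuous_levinsonMollifier_criticalLine N).norm).pow 2).mul
    ((Literature.NumberTheory.LFunctions.continuous_riemannZeta_line.norm).pow 2)).intervalIntegrable
    _ _

/-- `I_N(T₁, T₂) ≥ 0` for `T₁ ≤ T₂`. [cite: BettinGonek2017, §1] -/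
theorem mollifiedSecondMoment_nonneg (N : ℕ) {T₁ T₂ : ℝ} (h : T₁ ≤ T₂) :
    0 ≤ mollifiedSecondMoment N T₁ T₂ :=
  intervalIntegral.integral_nonneg h fun t _ ↦ by positivity

/-- Shifting a sum of non-negative terms: `∑_{N=1}^{K} (a N + a (N+1)) ≤ 2 ∑_{N=1}^{K+1} a N`. [folklore] -/
theorem sum_add_succ_le_two_mul {a : ℕ → ℝ} (ha : ∀ n, 0 ≤ a n) (K : ℕ) :
    ∑ N ∈ Finset.Icc 1 K, (a N + a (N + 1)) ≤ 2 * ∑ N ∈ Finset.Icc 1 (K + 1), a N := by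
  rw [Finset.sum_add_distrib, two_mul]
  refine add_le_add ?_ ?_
  · exact Finset.sum_le_sum_of_subset_of_nonneg (Finset.Icc_subset_Icc le_rfl (Nat.le_succ K))
      fun _ _ _ ↦ ha _
  · rw [← Finset.sum_image (f := a) (s := Finset.Icc 1 K) (g := fun N ↦ N + 1)
      (fun _ _ _ _ h ↦ by simpa using h)]
    refine Finset.sum_le_sum_of_subset_of_nonneg (fun M hM ↦ ?_) fun _ _ _ ↦ ha _
    simp only [Finset.mem_image, Finset.mem_Icc] at hM ⊢
    obtain ⟨N, ⟨h1, h2⟩, rfl⟩ := hM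
    omega

/-- **Integrating the key lower bound against `|ζ(½+it)|²` over `t ∈ [0, 1]`.** If for all `t`,
`c (x^{2β}/(1+|t|)⁴ + 1/x) ≤ ∫_1^x ‖M_y(½+it) log y‖² dy` (`x ≥ 2`, `c ≥ 0`), then
`(c x^{2β}/16) ∫_0^1 |ζ(½+it)|² dt ≤ 2 ∑_{N ≤ ⌊x⌋+1} log² N · I_N(0, 1)`.
[cite: BettinGonek2017, §2] -/
theorem BettinGonek2017_lowerBound_integrated {c β x : ℝ} (hx : 2 ≤ x) (hc : 0 ≤ c)
    (hlb : ∀ t : ℝ, c * (x ^ (2 * β) / (1 + |t|) ^ 4 + 1 / x) ≤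
      ∫ y in (1 : ℝ)..x, ‖levinsonMollifierLog y (1 / 2 + t * I)‖ ^ 2) :
    c * x ^ (2 * β) / 16 * (∫ t in (0 : ℝ)..1, ‖riemannZeta (1 / 2 + t * I)‖ ^ 2) ≤
      2 * ∑ N ∈ Finset.Icc 1 (⌊x⌋₊ + 1), Real.log N ^ 2 * mollifiedSecondMoment N 0 1 := by
  set K := ⌊x⌋₊ with hK
  set Z : ℝ → ℝ := fun t ↦ ‖riemannZeta (1 / 2 + t * I)‖ ^ 2 with hZ
  set L : ℕ → ℝ → ℝ := fun N t ↦ ‖levinsonMollifierLog (N : ℝ) (1 / 2 + t * I)‖ ^ 2 with hL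
  have hZc : Continuous Z :=
    (Literature.NumberTheory.LFunctions.continuous_riemannZeta_line.norm).pow 2
  have hLc : ∀ N, Continuous (L N) := fun N ↦
    ((continuous_levinsonMollifierLog (N : ℝ)).comp (by fun_prop)).norm.pow 2
  -- pointwise inequality on `[0, 1]`
  have hpt : ∀ t ∈ Set.Icc (0 : ℝ) 1,
      c * x ^ (2 * β) / 16 * Z t ≤ (2 * ∑ N ∈ Finset.Icc 1 (K + 1), L N t) * Z t := by
    intro t ht
    have hZ0 : 0 ≤ Z t := by positivity
    refine mul_le_mul_of_nonneg_right ?_ hZ0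
    have h16 : (1 + |t|) ^ 4 ≤ (16 : ℝ) := by
      have : |t| ≤ 1 := abs_le.2 ⟨by linarith [ht.1], ht.2⟩
      calc (1 + |t|) ^ 4 ≤ (1 + 1) ^ 4 := by gcongr
        _ = 16 := by norm_num
    have hx0 : 0 < x := by linarith
    have hxpow : 0 ≤ x ^ (2 * β) := Real.rpow_nonneg hx0.le _
    calc c * x ^ (2 * β) / 16 = c * (x ^ (2 * β) / 16 + 0) := by ring
      _ ≤ c * (x ^ (2 * β) / (1 + |t|) ^ 4 + 1 / x) := by
          gcongr
          positivity
      _ ≤ ∫ y in (1 : ℝ)..x, ‖levinsonMollifierLog y (1 / 2 + t * I)‖ ^ 2 := hlb t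
      _ ≤ ∑ N ∈ Finset.Icc 1 K, (L N t + L (N + 1) t) :=
          integral_norm_sq_levinsonMollifierLog_le (by linarith) (by norm_num)
      _ ≤ 2 * ∑ N ∈ Finset.Icc 1 (K + 1), L N t :=
          sum_add_succ_le_two_mul (a := fun N ↦ L N t) (fun _ ↦ by positivity) K
  -- integrate over `[0, 1]`
  have hRi : IntervalIntegrable (fun t ↦ (2 * ∑ N ∈ Finset.Icc 1 (K + 1), L N t) * Z t)
      volume 0 1 :=
    ((continuous_const.mul (continuous_finsetSum _ fun N _ ↦ hLc N)).mul hZc).intervalIntegrable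
      _ _
  have hLi : IntervalIntegrable (fun t ↦ c * x ^ (2 * β) / 16 * Z t) volume 0 1 :=
    (continuous_const.mul hZc).intervalIntegrable _ _
  have hint := intervalIntegral.integral_mono_on zero_le_one hLi hRi hpt
  rw [intervalIntegral.integral_const_mul] at hint
  refine hint.trans (le_of_eq ?_)
  have h1 : (fun t ↦ (2 * ∑ N ∈ Finset.Icc 1 (K + 1), L N t) * Z t) =
      fun t ↦ 2 * ∑ N ∈ Finset.Icc 1 (K + 1), L N t * Z t := by
    funext t; rw [mul_assoc, Finset.sum_mul]
  rw [h1, intervalIntegral.integral_const_mul,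
    intervalIntegral.integral_finsetSum (f := fun N t ↦ L N t * Z t)
      fun N _ ↦ ((hLc N).mul hZc).intervalIntegrable _ _]
  congr 1
  refine Finset.sum_congr rfl fun N _ ↦ ?_
  exact integral_norm_sq_levinsonMollifierLog_natCast N 0 1

/-- **Using the hypothesis of Theorem 1.** If `I_N(0, T') ≤ C T'^{1+ε}` for `2 ≤ N ≤ T'^θ`
(`T' ≥ 2`) and `K + 1 ≤ T'^θ`, then
`∑_{N ≤ K+1} log² N · I_N(0, 1) ≤ (K + 1) log²(K + 1) · C T'^{1+ε}` (the term `N = 1` vanishes,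
and `I_N(0, 1) ≤ I_N(0, T')`). [cite: BettinGonek2017, §2] -/
theorem sum_log_sq_mul_moment_le {θ ε C T' : ℝ} {K : ℕ} (hT' : 2 ≤ T') (hK1 : 1 ≤ K)
    (hK : ((K + 1 : ℕ) : ℝ) ≤ T' ^ θ)
    (hC : ∀ N : ℕ, 2 ≤ N → (N : ℝ) ≤ T' ^ θ → mollifiedSecondMoment N 0 T' ≤ C * T' ^ (1 + ε)) :
    ∑ N ∈ Finset.Icc 1 (K + 1), Real.log N ^ 2 * mollifiedSecondMoment N 0 1 ≤
      ((K + 1 : ℕ) : ℝ) * (Real.log ((K + 1 : ℕ) : ℝ) ^ 2 * (C * T' ^ (1 + ε))) := by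
  have h2K : ((2 : ℕ) : ℝ) ≤ T' ^ θ := le_trans (by exact_mod_cast (by omega : 2 ≤ K + 1)) hK
  have hC0 : 0 ≤ C * T' ^ (1 + ε) :=
    (mollifiedSecondMoment_nonneg 2 (by linarith)).trans (hC 2 le_rfl h2K)
  have hterm : ∀ N ∈ Finset.Icc 1 (K + 1), Real.log N ^ 2 * mollifiedSecondMoment N 0 1 ≤
      Real.log ((K + 1 : ℕ) : ℝ) ^ 2 * (C * T' ^ (1 + ε)) := by
    intro N hN
    obtain ⟨hN1, hNK⟩ := Finset.mem_Icc.1 hN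
    rcases eq_or_lt_of_le hN1 with h1 | h1
    · subst h1
      simp only [Nat.cast_one, Real.log_one, ne_eq, OfNat.ofNat_ne_zero, not_false_eq_true,
        zero_pow, zero_mul]
      exact mul_nonneg (sq_nonneg _) hC0
    · have hN2 : 2 ≤ N := by omega
      have hlog : Real.log N ^ 2 ≤ Real.log ((K + 1 : ℕ) : ℝ) ^ 2 := by
        have h0 : 0 ≤ Real.log N := Real.log_nonneg (by exact_mod_cast hN1)
        have h1' : Real.log N ≤ Real.log ((K + 1 : ℕ) : ℝ) :=
          Real.log_le_log (by exact_mod_cast (by omega : 0 < N)) (by exact_mod_cast hNK)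
        nlinarith
      have hmom : mollifiedSecondMoment N 0 1 ≤ C * T' ^ (1 + ε) :=
        (mollifiedSecondMoment_mono N zero_le_one (by linarith)).trans
          (hC N hN2 ((show (N : ℝ) ≤ ((K + 1 : ℕ) : ℝ) by exact_mod_cast hNK).trans hK))
      exact mul_le_mul hlog hmom (mollifiedSecondMoment_nonneg N zero_le_one) (sq_nonneg _)
  calc ∑ N ∈ Finset.Icc 1 (K + 1), Real.log N ^ 2 * mollifiedSecondMoment N 0 1
      ≤ ∑ N ∈ Finset.Icc 1 (K + 1), Real.log ((K + 1 : ℕ) : ℝ) ^ 2 * (C * T' ^ (1 + ε)) :=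
        Finset.sum_le_sum hterm
    _ = ((K + 1 : ℕ) : ℝ) * (Real.log ((K + 1 : ℕ) : ℝ) ^ 2 * (C * T' ^ (1 + ε))) := by
        rw [Finset.sum_const, Nat.card_Icc, nsmul_eq_mul]; simp

/-- A function bounded on a tail cannot be `T^η`, `η > 0`. [folklore] -/
theorem false_of_rpow_le {η B T₀ : ℝ} (hη : 0 < η) (h : ∀ T : ℝ, T₀ ≤ T → T ^ η ≤ B) : False := by
  obtain ⟨T, hT1, hT2⟩ := (((tendsto_rpow_atTop hη).eventually_gt_atTop B).and
    (Filter.eventually_ge_atTop T₀)).exists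
  exact absurd (h T hT2) (not_le.2 hT1)

/-! ## The key lower bound (Bettin–Gonek 2017, §2) as a named fact -/

/-- **Bettin–Gonek 2017, §2, the display after Cauchy–Schwarz** (the analytic heart of the proof
of Theorems 1 and 2). "Let `ρ₀ = β₀ + iγ₀` be a fixed zero of `ζ(w)` with `β₀ ≥ ½`. […] It follows
from the Cauchy–Schwarz inequality that
`x^{2β₀}/(1+|t|)⁴ + 1/x ≪ ∫_1^x |M_y(½+it)|² log² y dy` for `x ≥ 2`" (all real `t`; the implied
constant depends on `ρ₀` only; `M_y(½+it) log y = levinsonMollifierLog y (½+it)`). Printed proof: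
Mellin transform `H_t(w) = ∫_1^∞ M_x(½+it) log x · x^{-w} dx = 1/((w−1)² ζ(w−½+it))`, the kernel
`G_t(w) = (w−1)²(w−3/2+it)ζ(w−½+it)/((w+1)²(w−½+it−ρ₀)(w+it+1)⁴)`, `J_t(x) = (1/2πi)∫_(3) G_t H_t x^w dw`
evaluated by Mellin convolution (`≪ ∫_1^x |M_y| log y dy`) and by moving the line to `Re w = 0`
(residue `x^{ρ₀+½−it}(ρ₀−1)/((3/2+ρ₀−it)²(ρ₀+3/2)⁴)` plus `O(1)`).
[cite: BettinGonek2017, §2] -/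
def BettinGonek2017_lowerBound : Prop :=
  ∀ ρ₀ : ℂ, riemannZeta ρ₀ = 0 → 1 / 2 ≤ ρ₀.re →
    ∃ c : ℝ, 0 < c ∧ ∀ x : ℝ, 2 ≤ x → ∀ t : ℝ,
      c * (x ^ (2 * ρ₀.re) / (1 + |t|) ^ 4 + 1 / x) ≤
        ∫ y in (1 : ℝ)..x, ‖levinsonMollifierLog y (1 / 2 + t * I)‖ ^ 2

/-! ## Theorem 1 from the key lower bound -/

/-- **Bettin–Gonek 2017, Theorem 1, from the key lower bound of §2** (the last paragraph of the
printed proof, with the integer/real-length bridge made explicit): if `ζ(ρ₀) = 0` with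
`β₀ > ½ + 1/(2θ)`, integrate the lower bound against `|ζ(½+it)|²` over `t ∈ [0, 1]`, bound
`∫_0^1 |M_y log y|²|ζ|² dt` through `I_N(0,T)`, `N = ⌊y⌋, ⌊y⌋ + 1 ≤ 2T^θ = (2^{1/θ}T)^θ`, take
`x = T^θ` and let `T → ∞`: `T^{2β₀θ} ≪ T^{θ+1+ε} log² T`, contradiction.
[cite: BettinGonek2017, Theorem 1] -/
theorem BettinGonek2017_thm1_of_lowerBound (hLB : BettinGonek2017_lowerBound) :
    BettinGonek2017_thm1 := by
  intro θ hθ hyp s hs hζ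
  have hθ2 : 0 < 2 * θ := by positivity
  have hβ : 1 / 2 < s.re := by
    have : 0 < 1 / (2 * θ) := by positivity
    linarith
  have hgap : θ + 1 < 2 * s.re * θ := by
    have h := mul_lt_mul_of_pos_right hs hθ2
    have e : (1 / 2 + 1 / (2 * θ)) * (2 * θ) = θ + 1 := by field_simp
    rw [e] at h; linarith
  set η : ℝ := (2 * s.re * θ - θ - 1) / 4 with hη
  have hη0 : 0 < η := by rw [hη]; linarith
  obtain ⟨C, hC⟩ := hyp η hη0
  obtain ⟨c, hc, hlb⟩ := hLB s hζ hβ.le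
  set κ : ℝ := ∫ t in (0 : ℝ)..1, ‖riemannZeta (1 / 2 + t * I)‖ ^ 2 with hκdef
  have hκ : 0 < κ := integral_norm_sq_riemannZeta_pos
  -- constants
  set A : ℝ := (2 : ℝ) ^ (1 / θ) with hA
  have hA1 : 1 ≤ A := Real.one_le_rpow (by norm_num) (by positivity)
  have hAθ : A ^ θ = 2 := by
    rw [hA, ← Real.rpow_mul (by norm_num), one_div_mul_cancel hθ.ne', Real.rpow_one]
  set D : ℝ := 4 * (C * A ^ (1 + η)) * ((1 + θ) / η) ^ 2 with hD
  refine false_of_rpow_le (η := η) (B := 16 * D / (c * κ)) (T₀ := max 2 A) hη0 fun T hT ↦ ?_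
  -- fix a large `T`
  have hT2 : 2 ≤ T := le_trans (le_max_left _ _) hT
  have hTA : A ≤ T := le_trans (le_max_right _ _) hT
  have hT0 : 0 < T := by linarith
  set x : ℝ := T ^ θ with hx
  have hx2 : 2 ≤ x := by
    rw [hx, ← hAθ]; exact Real.rpow_le_rpow (by linarith) hTA hθ.le
  have hx0 : 0 < x := by linarith
  set K := ⌊x⌋₊ with hK
  have hK1 : 1 ≤ K := Nat.le_floor (by norm_num; linarith)
  have hKx : (K : ℝ) ≤ x := Nat.floor_le hx0.le
  set T' : ℝ := A * T with hT'
  have hT'2 : 2 ≤ T' := by rw [hT']; nlinarith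
  have hT'θ : T' ^ θ = 2 * x := by
    rw [hT', Real.mul_rpow (by linarith) hT0.le, hAθ]
  have hKT' : ((K + 1 : ℕ) : ℝ) ≤ T' ^ θ := by
    rw [hT'θ]; push_cast; linarith
  -- the two halves
  have h1 := BettinGonek2017_lowerBound_integrated (β := s.re) hx2 hc.le (hlb x hx2)
  have h2 := sum_log_sq_mul_moment_le (ε := η) hT'2 hK1 hKT' (hC T' hT'2)
  have h12 : c * x ^ (2 * s.re) / 16 * κ ≤
      2 * (((K + 1 : ℕ) : ℝ) * (Real.log ((K + 1 : ℕ) : ℝ) ^ 2 * (C * T' ^ (1 + η)))) :=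
    h1.trans (by linarith)
  -- sizes of the factors on the right
  have hC0 : 0 ≤ C * T' ^ (1 + η) :=
    (mollifiedSecondMoment_nonneg 2 (by linarith)).trans
      (hC T' hT'2 2 le_rfl (le_trans (by exact_mod_cast (by omega : 2 ≤ K + 1)) hKT'))
  have hK2x : ((K + 1 : ℕ) : ℝ) ≤ 2 * x := by push_cast; linarith
  have hlogT : Real.log T ≤ T ^ η / η := Real.log_le_rpow_div hT0.le hη0
  have hlogT0 : 0 ≤ Real.log T := Real.log_nonneg (by linarith)
  have hlog2x : Real.log ((K + 1 : ℕ) : ℝ) ≤ (1 + θ) / η * T ^ η := by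
    calc Real.log ((K + 1 : ℕ) : ℝ) ≤ Real.log (2 * x) :=
          Real.log_le_log (by positivity) hK2x
      _ = Real.log 2 + θ * Real.log T := by
          rw [Real.log_mul (by norm_num) hx0.ne', hx, Real.log_rpow hT0]
      _ ≤ Real.log T + θ * Real.log T := by
          gcongr
      _ = (1 + θ) * Real.log T := by ring
      _ ≤ (1 + θ) * (T ^ η / η) := by gcongr
      _ = (1 + θ) / η * T ^ η := by ring
  have hlog0 : 0 ≤ Real.log ((K + 1 : ℕ) : ℝ) := Real.log_nonneg (by exact_mod_cast (by omega))
  have hT'pow : T' ^ (1 + η) = A ^ (1 + η) * T ^ (1 + η) := by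
    rw [hT', Real.mul_rpow (by linarith) hT0.le]
  have hrhs : 2 * (((K + 1 : ℕ) : ℝ) * (Real.log ((K + 1 : ℕ) : ℝ) ^ 2 * (C * T' ^ (1 + η)))) ≤
      D * (T ^ θ * (T ^ η) ^ 2 * T ^ (1 + η)) := by
    have hCT : C * T' ^ (1 + η) = C * A ^ (1 + η) * T ^ (1 + η) := by rw [hT'pow]; ring
    rw [hCT] at hC0 ⊢
    calc 2 * (((K + 1 : ℕ) : ℝ) * (Real.log ((K + 1 : ℕ) : ℝ) ^ 2 * (C * A ^ (1 + η) * T ^ (1 + η))))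
        ≤ 2 * ((2 * x) * (((1 + θ) / η * T ^ η) ^ 2 * (C * A ^ (1 + η) * T ^ (1 + η)))) := by
          gcongr
      _ = D * (T ^ θ * (T ^ η) ^ 2 * T ^ (1 + η)) := by rw [hD, hx]; ring
  -- exponent bookkeeping
  have hexp : T ^ θ * (T ^ η) ^ 2 * T ^ (1 + η) = T ^ (θ + 1 + 3 * η) := by
    rw [sq, ← Real.rpow_add hT0, ← Real.rpow_add hT0, ← Real.rpow_add hT0]; ring_nf
  have hlhs : x ^ (2 * s.re) = T ^ (θ + 1 + 3 * η) * T ^ η := by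
    rw [hx, ← Real.rpow_mul hT0.le, ← Real.rpow_add hT0]
    congr 1; rw [hη]; ring
  have hmain : c * κ / 16 * (T ^ (θ + 1 + 3 * η) * T ^ η) ≤ D * T ^ (θ + 1 + 3 * η) := by
    have := h12.trans hrhs
    rw [hexp, hlhs] at this
    linarith
  have hpos : 0 < T ^ (θ + 1 + 3 * η) := Real.rpow_pos_of_pos hT0 _
  have hcκ : 0 < c * κ := mul_pos hc hκ
  rw [le_div_iff₀ hcκ]
  have : c * κ * T ^ η ≤ 16 * D := by
    by_contra hcon
    rw [not_le] at hcon
    have : D * T ^ (θ + 1 + 3 * η) < c * κ / 16 * (T ^ (θ + 1 + 3 * η) * T ^ η) := by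
      have := mul_lt_mul_of_pos_right hcon hpos
      nlinarith
    linarith
  linarith

/-! ## Assembly of the barrier from its four leaves -/

/-- **`MollifierLimitations` from its printed inputs**: Radziwiłł's Proposition A, Lemma 5 and
Proposition B (giving `Radziwill2012_thm1` by `Radziwill2012_thm1_of_inputs`) and Bettin–Gonek's
§2 lower bound (giving `BettinGonek2017_thm1` by `BettinGonek2017_thm1_of_lowerBound`).
[cite: Radziwill2012, §4] [cite: BettinGonek2017, §2] -/
theorem MollifierLimitations_of (hA : Radziwill2012_propA) (h5 : Radziwill2012_lemma5)
    (hB : Radziwill2012_propB) (hLB : BettinGonek2017_lowerBound) : MollifierLimitations :=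
  ⟨Radziwill2012_thm1_of_inputs hA h5 hB, BettinGonek2017_thm1_of_lowerBound hLB⟩

end Literature.Barriers.RiemannHypothesis
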